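import Mathlib
import Summits.KontsevichZagierPeriods.KontsevichZagierPeriods.Theorems.ScissorsTransportPolytopeTransportPoly

/-!
# Polytope transport — rational affine functions and the tools of the linear cell decomposition

Helper file for `PolytopeTransport` (stmt-KontsevichZagierPeriods-10815, route ScissorsTransport).
`LinQ n = (Fin n → ℚ) × ℚ` encodes the affine function `x ↦ ∑ cᵢ xᵢ + e` on `ℝⁿ` with rational
coefficients (`LinQ.ev`), also as a `ℚ`-polynomial (`LinQ.toPoly`). With the first coordinate
distinguished, `f(x) = lead f · x₀ + (flat f)(tail x) = lead f · (x₀ − (root f)(tail x))`. We record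
sign conditions (`LinQ.signSets`) and their transfer along a cell, the rational box `cbox`, and two
null-set computations in `ℝ × ℝⁿ` coordinates: cylinders over null sets and graphs of continuous
functions of the tail are null. Folklore (the linear case of cylindrical algebraic decomposition,
Bochnak–Coste–Roy 1998, §2.3).
-/

noncomputable section

open Set MvPolynomial MeasureTheory
open scoped BigOperators

namespace Summit.KontsevichZagierPeriods.ScissorsTransport.PolytopeTransport

/-- Affine functions on `ℝⁿ` with rational coefficients: `(c, e) ↦ (x ↦ ∑ cᵢ xᵢ + e)`. [folklore] -/
abbrev LinQ (n : ℕ) : Type := (Fin n → ℚ) × ℚ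

namespace LinQ

variable {n : ℕ}

/-- Evaluation of a rational affine function at a real point. [folklore] -/
def ev (f : LinQ n) (x : Fin n → ℝ) : ℝ := ∑ i, (f.1 i : ℝ) * x i + f.2

/-- The constant affine function. [folklore] -/
def const (n : ℕ) (e : ℚ) : LinQ n := (0, e)

/-- Evaluation of a constant. [folklore] -/
@[simp] theorem ev_const (e : ℚ) (x : Fin n → ℝ) : ev (const n e) x = e := by simp [ev, const]

/-- Evaluation is additive: differences. [folklore] -/
@[simp] theorem ev_sub (f g : LinQ n) (x : Fin n → ℝ) : ev (f - g) x = ev f x - ev g x := by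
  simp only [ev, Prod.fst_sub, Prod.snd_sub, Pi.sub_apply, Rat.cast_sub, sub_mul,
    Finset.sum_sub_distrib]
  ring

/-- Evaluation of `0`. [folklore] -/
@[simp] theorem ev_zero (x : Fin n → ℝ) : ev (0 : LinQ n) x = 0 := by simp [ev]

/-- Evaluation is homogeneous. [folklore] -/
@[simp] theorem ev_smul (c : ℚ) (f : LinQ n) (x : Fin n → ℝ) : ev (c • f) x = c * ev f x := by
  simp only [ev, Prod.smul_fst, Prod.smul_snd, Pi.smul_apply, smul_eq_mul, Rat.cast_mul, mul_add,
    Finset.mul_sum, mul_assoc]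

/-- The affine function as a `ℚ`-polynomial. [folklore] -/
def toPoly (f : LinQ n) : MvPolynomial (Fin n) ℚ := ∑ i, C (f.1 i) * X i + C f.2

/-- The polynomial of `f` evaluates to `f`. [folklore] -/
@[simp] theorem aeval_toPoly (f : LinQ n) (x : Fin n → ℝ) : aeval x (toPoly f) = ev f x := by
  simp [toPoly, ev]

/-- Evaluation is continuous. [folklore] -/
theorem continuous_ev (f : LinQ n) : Continuous (ev f) := by
  have := continuous_aeval (toPoly f)
  simpa only [aeval_toPoly] using this

/-- The leading coefficient (of `x₀`). [folklore] -/
def lead (f : LinQ (n + 1)) : ℚ := f.1 0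

/-- The part not involving `x₀`, as an affine function of the tail. [folklore] -/
def flat (f : LinQ (n + 1)) : LinQ n := (fun i => f.1 i.succ, f.2)

/-- The root function: `f(x) = 0 ↔ x₀ = (root f)(tail x)` when `lead f ≠ 0`. [folklore] -/
def root (f : LinQ (n + 1)) : LinQ n := (-(lead f)⁻¹) • flat f

/-- `f(x) = lead f · x₀ + (flat f)(tail x)`. [folklore] -/
theorem ev_eq_lead_mul_add (f : LinQ (n + 1)) (x : Fin (n + 1) → ℝ) :
    ev f x = lead f * x 0 + ev (flat f) (Fin.tail x) := by
  simp only [ev, Fin.sum_univ_succ, lead, flat, Fin.tail]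
  ring

/-- `f(x) = lead f · (x₀ − (root f)(tail x))` when `lead f ≠ 0`. [folklore] -/
theorem ev_eq_lead_mul_sub_root (f : LinQ (n + 1)) (hf : lead f ≠ 0) (x : Fin (n + 1) → ℝ) :
    ev f x = lead f * (x 0 - ev (root f) (Fin.tail x)) := by
  rw [ev_eq_lead_mul_add, root, ev_smul]
  have : (lead f : ℝ) ≠ 0 := by exact_mod_cast hf
  push_cast
  field_simp
  ring

/-- `f(x) = (flat f)(tail x)` when `lead f = 0`. [folklore] -/
theorem ev_of_lead_eq_zero (f : LinQ (n + 1)) (hf : lead f = 0) (x : Fin (n + 1) → ℝ) :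
    ev f x = ev (flat f) (Fin.tail x) := by
  rw [ev_eq_lead_mul_add, hf]
  simp

end LinQ

/-! ### Sign conditions -/

/-- The sets on which `f` has constant sign (`> 0`, `< 0` or `= 0` throughout). [folklore] -/
def LinQ.signSets {n : ℕ} (f : LinQ n) : Set (Set (Fin n → ℝ)) :=
  {S | (∀ x ∈ S, 0 < f.ev x) ∨ (∀ x ∈ S, f.ev x < 0) ∨ (∀ x ∈ S, f.ev x = 0)}

/-- Unfolding of `signSets`. [folklore] -/
theorem LinQ.mem_signSets {n : ℕ} {f : LinQ n} {S : Set (Fin n → ℝ)} :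
    S ∈ f.signSets ↔ (∀ x ∈ S, 0 < f.ev x) ∨ (∀ x ∈ S, f.ev x < 0) ∨ (∀ x ∈ S, f.ev x = 0) := Iff.rfl

namespace SignConst

variable {n : ℕ} {S : Set (Fin n → ℝ)} {r s : LinQ n}

/-- Transfer of a strict inequality between two affine functions from one point of `S` to all of
`S`, given that their difference has constant sign. [folklore] -/
theorem lt_of_lt (h : S ∈ (r - s).signSets) {y : Fin n → ℝ} (hy : y ∈ S) (hlt : r.ev y < s.ev y) :
    ∀ x ∈ S, r.ev x < s.ev x := by
  rcases h with h | h | h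
  · have := h y hy; rw [LinQ.ev_sub] at this; linarith
  · intro x hx; have := h x hx; rw [LinQ.ev_sub] at this; linarith
  · have := h y hy; rw [LinQ.ev_sub] at this; linarith

/-- Transfer of an equality. [folklore] -/
theorem eq_of_eq (h : S ∈ (r - s).signSets) {y : Fin n → ℝ} (hy : y ∈ S) (heq : r.ev y = s.ev y) :
    ∀ x ∈ S, r.ev x = s.ev x := by
  rcases h with h | h | h
  · have := h y hy; rw [LinQ.ev_sub] at this; linarith
  · have := h y hy; rw [LinQ.ev_sub] at this; linarith
  · intro x hx; have := h x hx; rw [LinQ.ev_sub] at this; linarith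

/-- Transfer of a non-strict inequality. [folklore] -/
theorem le_of_le (h : S ∈ (r - s).signSets) {y : Fin n → ℝ} (hy : y ∈ S) (hle : r.ev y ≤ s.ev y) :
    ∀ x ∈ S, r.ev x ≤ s.ev x := by
  rcases hle.lt_or_eq with hlt | heq
  · exact fun x hx => (lt_of_lt h hy hlt x hx).le
  · exact fun x hx => (eq_of_eq h hy heq x hx).le

/-- Transfer of a strict inequality in the other direction. [folklore] -/
theorem gt_of_gt (h : S ∈ (r - s).signSets) {y : Fin n → ℝ} (hy : y ∈ S) (hlt : s.ev y < r.ev y) :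
    ∀ x ∈ S, s.ev x < r.ev x := by
  rcases h with h | h | h
  · intro x hx; have := h x hx; rw [LinQ.ev_sub] at this; linarith
  · have := h y hy; rw [LinQ.ev_sub] at this; linarith
  · have := h y hy; rw [LinQ.ev_sub] at this; linarith

end SignConst

/-! ### The rational box -/

/-- The open box `(-R, R)ⁿ`. [folklore] -/
def cbox (n : ℕ) (R : ℚ) : Set (Fin n → ℝ) := {x | ∀ i, -(R : ℝ) < x i ∧ x i < R}

/-- Membership in the box, first coordinate split off. [folklore] -/
theorem mem_cbox_succ {n : ℕ} {R : ℚ} {x : Fin (n + 1) → ℝ} :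
    x ∈ cbox (n + 1) R ↔ (-(R : ℝ) < x 0 ∧ x 0 < R) ∧ Fin.tail x ∈ cbox n R := by
  simp only [cbox, mem_setOf_eq, Fin.forall_fin_succ]
  rfl

/-- The box in dimension `0` is the point. [folklore] -/
@[simp] theorem cbox_zero (R : ℚ) : cbox 0 R = univ := by
  ext x; simp [cbox]

/-! ### Null sets in `ℝ × ℝⁿ` coordinates -/

section Null

variable {n : ℕ}

/-- The measurable equivalence `ℝⁿ⁺¹ ≃ ℝ × ℝⁿ`, `x ↦ (x₀, tail x)`. [folklore] -/
def splitEquiv (n : ℕ) : (Fin (n + 1) → ℝ) ≃ᵐ ℝ × (Fin n → ℝ) :=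
  MeasurableEquiv.piFinSuccAbove (fun _ => ℝ) 0

/-- `splitEquiv n x = (x₀, tail x)`. [folklore] -/
theorem splitEquiv_apply (x : Fin (n + 1) → ℝ) : splitEquiv n x = (x 0, Fin.tail x) := by
  simp [splitEquiv]

/-- The splitting preserves Lebesgue measure. [folklore] -/
theorem volume_preserving_splitEquiv (n : ℕ) : MeasurePreserving (splitEquiv n) volume volume :=
  volume_preserving_piFinSuccAbove (fun _ => ℝ) 0

/-- Preimages under the splitting have the same volume. [folklore] -/
theorem volume_preimage_splitEquiv (S : Set (ℝ × (Fin n → ℝ))) :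
    volume (splitEquiv n ⁻¹' S) = volume S := by
  calc volume (splitEquiv n ⁻¹' S) = Measure.map (splitEquiv n) volume S :=
        ((splitEquiv n).map_apply S).symm
    _ = volume S := by rw [(volume_preserving_splitEquiv n).map_eq]

/-- A cylinder over a null set of tails is null. [folklore] -/
theorem volume_setOf_tail_mem_null {N : Set (Fin n → ℝ)} (hN : volume N = 0) :
    volume {x : Fin (n + 1) → ℝ | Fin.tail x ∈ N} = 0 := by
  have h1 : {x : Fin (n + 1) → ℝ | Fin.tail x ∈ N} = splitEquiv n ⁻¹' (univ ×ˢ N) := by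
    ext x; simp [splitEquiv_apply]
  rw [h1, volume_preimage_splitEquiv, Measure.volume_eq_prod, Measure.prod_prod, hN, mul_zero]

/-- The graph `{x | x₀ = g (tail x)}` of a continuous function of the tail is null. [folklore] -/
theorem volume_setOf_eq_tail_null {g : (Fin n → ℝ) → ℝ} (hg : Continuous g) :
    volume {x : Fin (n + 1) → ℝ | x 0 = g (Fin.tail x)} = 0 := by
  have h1 : {x : Fin (n + 1) → ℝ | x 0 = g (Fin.tail x)} =
      splitEquiv n ⁻¹' {p : ℝ × (Fin n → ℝ) | p.1 = g p.2} := by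
    ext x; simp [splitEquiv_apply]
  have hmeas : MeasurableSet {p : ℝ × (Fin n → ℝ) | p.1 = g p.2} :=
    (isClosed_eq continuous_fst (hg.comp continuous_snd)).measurableSet
  rw [h1, volume_preimage_splitEquiv, Measure.volume_eq_prod, Measure.prod_apply_symm hmeas]
  simp [Set.preimage, Set.setOf_eq_eq_singleton]

end Null

end Summit.KontsevichZagierPeriods.ScissorsTransport.PolytopeTransport
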